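import Literature.MathematicalPhysics.QuantumFieldTheory.TwistedPartitionFunction
import HarnessLib

/-!
# Crux `NonSimplyConnectedLatticeGap` (stmt-QuantumFields-16405), route `ConvexGribovBody`, line `Sketch` —
# stub `stub_twistStackTransport` ("the twist is a boundary condition", observable level)

't Hooft's twisted Wilson weight on the symmetric discrete torus `(ℤ/L)^d` ('t Hooft, Nucl. Phys.
B 153 (1979) 141; Greensite, LNP 821 (2011) §4.3 (4.36)–(4.37), §4.4 (4.42)–(4.43)) inserts a
central element `z ∈ Z(G)` into the plaquettes of one coordinate plane `q = (μ, ν)` based in the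
co-dimension-two stack `{x_μ = a, x_ν = b}`; write
`S_{a,b} = insertedWilsonAction ρ (stackInsertion z q a b)` for the twisted action and `dU` for the
product of the normalised Haar measures over the positively oriented links.

**Transport of the stack at the level of observables.** Let `c` be the centre-valued link
function equal to `z⁻¹` on the `ν`-links based at the sites `y` with `y_μ = a + 1`, `y_ν = b`, and
to `1` elsewhere. Its plaquette coboundary moves the stack one step in direction `μ`:
`S_{a,b}(cU) = S_{a+1,b}(U)` (`stackInsertion_mul_coboundary_fst`,
`insertedWilsonAction_central_mul`). Hence for every integrand `F` which is blind to the
substitution `U ↦ cU`,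

  `∫ F(U) exp(-β S_{a+1,b}(U)) dU = ∫ F(cU) exp(-β S_{a,b}(cU)) dU = ∫ F(U) exp(-β S_{a,b}(U)) dU`

by left invariance of the product Haar measure (`MeasureTheory.integral_mul_left_eq_self`); no
continuity of `ρ` is needed. This is `integral_mul_exp_stackInsertion_add_one_fst` (and the
registered stub `stub_twistStackTransport`); the general coboundary form is
`integral_mul_exp_insertedWilsonAction_mul_coboundary`, the step in direction `ν` is
`integral_mul_exp_stackInsertion_add_one_snd`, and dividing by the (equal) twisted partition
functions gives the equality of twisted expectations
(`twistedExpectation_add_one_fst` / `_snd`).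
-/

set_option autoImplicit false

noncomputable section

open MeasureTheory Literature.MathematicalPhysics.QuantumFieldTheory

namespace Summit.QuantumFields.YangMills.Theorems.NonSimplyConnectedLatticeGap

section Transport

variable {d L N : ℕ} [NeZero L] {G : Type*} [Group G] [TopologicalSpace G] [IsTopologicalGroup G]
  [CompactSpace G] [MeasurableSpace G] [BorelSpace G] (ρ : G →* Matrix (Fin N) (Fin N) ℂ) (β : ℝ)

/-- **Coboundary transport of twisted weights, observable level.** For a centre-valued link
function `c` and an integrand `F` invariant under the substitution `U ↦ cU`, multiplying the
plaquette insertion `t` by the coboundary of `c` does not change `∫ F exp(-β S_t)`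
(substitute `U_e ↦ c_e U_e`, left invariance of the product Haar measure).
[cite: Greensite2011Confinement, §4.3 (4.36)–(4.37), §4.4 (4.42)–(4.43)] -/
theorem integral_mul_exp_insertedWilsonAction_mul_coboundary {c : Edge d L → G}
    (hc : ∀ e, c e ∈ Subgroup.center G) (t : Plaquette d L → G) (F : GaugeConfig d L G → ℝ)
    (hF : ∀ U : GaugeConfig d L G, F (c * U) = F U) :
    (∫ U : GaugeConfig d L G, F U * Real.exp (-(β * insertedWilsonAction ρ
        (fun p => t p * plaquetteCoboundary c p) U))
        ∂(Measure.pi fun _ : Edge d L => haarProbability G)) =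
      ∫ U : GaugeConfig d L G, F U * Real.exp (-(β * insertedWilsonAction ρ t U))
        ∂(Measure.pi fun _ : Edge d L => haarProbability G) := by
  calc ∫ U : GaugeConfig d L G, F U * Real.exp (-(β * insertedWilsonAction ρ
          (fun p => t p * plaquetteCoboundary c p) U))
          ∂(Measure.pi fun _ : Edge d L => haarProbability G)
      = ∫ U : GaugeConfig d L G, F (c * U) * Real.exp (-(β * insertedWilsonAction ρ t (c * U)))
          ∂(Measure.pi fun _ : Edge d L => haarProbability G) := by
        simp only [insertedWilsonAction_central_mul ρ hc, hF]
    _ = _ := integral_mul_left_eq_self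
        (fun U : GaugeConfig d L G => F U * Real.exp (-(β * insertedWilsonAction ρ t U))) c

/-- **Moving the stack one step in direction `μ = q.1`, observable level**: for central `z` and an
integrand `F` blind to the substitution `U ↦ cU`, `c = z⁻¹` on the `ν`-links based in
`{y_μ = a + 1, y_ν = b}` and `1` elsewhere,
`∫ F exp(-β S_{a+1,b}) dU = ∫ F exp(-β S_{a,b}) dU`.
[cite: Greensite2011Confinement, §4.3 (4.36)–(4.37), §4.4 (4.42)–(4.43)] -/
theorem integral_mul_exp_stackInsertion_add_one_fst {z : G} (hz : z ∈ Subgroup.center G)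
    (q : {p : Fin d × Fin d // p.1 < p.2}) (a b : ZMod L) (F : GaugeConfig d L G → ℝ)
    (hF : ∀ U : GaugeConfig d L G,
      F ((fun e : Edge d L => if e.2 = q.1.2 ∧ e.1 q.1.1 = a + 1 ∧ e.1 q.1.2 = b then z⁻¹ else 1) *
        U) = F U) :
    (∫ U : GaugeConfig d L G, F U * Real.exp (-(β * insertedWilsonAction ρ
        (stackInsertion z q (a + 1) b) U)) ∂(Measure.pi fun _ : Edge d L => haarProbability G)) =
      ∫ U : GaugeConfig d L G, F U * Real.exp (-(β * insertedWilsonAction ρ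
        (stackInsertion z q a b) U)) ∂(Measure.pi fun _ : Edge d L => haarProbability G) := by
  have hst : stackInsertion z q (a + 1) b = fun p : Plaquette d L => stackInsertion z q a b p *
      plaquetteCoboundary (fun e : Edge d L =>
        if e.2 = q.1.2 ∧ e.1 q.1.1 = a + 1 ∧ e.1 q.1.2 = b then z⁻¹ else 1) p :=
    funext fun p => (stackInsertion_mul_coboundary_fst z q a b p).symm
  rw [hst]
  exact integral_mul_exp_insertedWilsonAction_mul_coboundary ρ β
    (fun e => by
      split_ifs
      exacts [Subgroup.inv_mem _ hz, Subgroup.one_mem _]) (stackInsertion z q a b) F hF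

/-- **Moving the stack one step in direction `ν = q.2`, observable level**: for central `z` and an
integrand `F` blind to the substitution `U ↦ cU`, `c = z` on the `μ`-links based in
`{y_μ = a, y_ν = b + 1}` and `1` elsewhere,
`∫ F exp(-β S_{a,b+1}) dU = ∫ F exp(-β S_{a,b}) dU`.
[cite: Greensite2011Confinement, §4.3 (4.36)–(4.37), §4.4 (4.42)–(4.43)] -/
theorem integral_mul_exp_stackInsertion_add_one_snd {z : G} (hz : z ∈ Subgroup.center G)
    (q : {p : Fin d × Fin d // p.1 < p.2}) (a b : ZMod L) (F : GaugeConfig d L G → ℝ)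
    (hF : ∀ U : GaugeConfig d L G,
      F ((fun e : Edge d L => if e.2 = q.1.1 ∧ e.1 q.1.1 = a ∧ e.1 q.1.2 = b + 1 then z else 1) *
        U) = F U) :
    (∫ U : GaugeConfig d L G, F U * Real.exp (-(β * insertedWilsonAction ρ
        (stackInsertion z q a (b + 1)) U)) ∂(Measure.pi fun _ : Edge d L => haarProbability G)) =
      ∫ U : GaugeConfig d L G, F U * Real.exp (-(β * insertedWilsonAction ρ
        (stackInsertion z q a b) U)) ∂(Measure.pi fun _ : Edge d L => haarProbability G) := by
  have hst : stackInsertion z q a (b + 1) = fun p : Plaquette d L => stackInsertion z q a b p *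
      plaquetteCoboundary (fun e : Edge d L =>
        if e.2 = q.1.1 ∧ e.1 q.1.1 = a ∧ e.1 q.1.2 = b + 1 then z else 1) p :=
    funext fun p => (stackInsertion_mul_coboundary_snd z q a b p).symm
  rw [hst]
  exact integral_mul_exp_insertedWilsonAction_mul_coboundary ρ β
    (fun e => by
      split_ifs
      exacts [hz, Subgroup.one_mem _]) (stackInsertion z q a b) F hF

/-- The twisted partition functions of the stacks `(a + 1, b)` and `(a, b)` agree (central `z`;
`twistedPartitionFunctionAt_add_one_fst` in inserted form). [cite: Greensite2011Confinement, §4.4 (4.42)–(4.43)] -/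
theorem insertedPartitionFunction_stackInsertion_add_one_fst {z : G} (hz : z ∈ Subgroup.center G)
    (q : {p : Fin d × Fin d // p.1 < p.2}) (a b : ZMod L) :
    insertedPartitionFunction ρ β L (stackInsertion z q (a + 1) b) =
      insertedPartitionFunction ρ β L (stackInsertion z q a b) := by
  rw [← twistedPartitionFunctionAt_eq_inserted, ← twistedPartitionFunctionAt_eq_inserted]
  exact twistedPartitionFunctionAt_add_one_fst ρ β hz q a b

/-- The twisted partition functions of the stacks `(a, b + 1)` and `(a, b)` agree (central `z`;
`twistedPartitionFunctionAt_add_one_snd` in inserted form). [cite: Greensite2011Confinement, §4.4 (4.42)–(4.43)] -/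
theorem insertedPartitionFunction_stackInsertion_add_one_snd {z : G} (hz : z ∈ Subgroup.center G)
    (q : {p : Fin d × Fin d // p.1 < p.2}) (a b : ZMod L) :
    insertedPartitionFunction ρ β L (stackInsertion z q a (b + 1)) =
      insertedPartitionFunction ρ β L (stackInsertion z q a b) := by
  rw [← twistedPartitionFunctionAt_eq_inserted, ← twistedPartitionFunctionAt_eq_inserted]
  exact twistedPartitionFunctionAt_add_one_snd ρ β hz q a b

/-- **Twisted expectations do not see the position of the stack (step in direction `μ`).** Under
the hypothesis of `integral_mul_exp_stackInsertion_add_one_fst` the normalised twisted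
expectations `⟨F⟩_{a+1,b} = ∫ F exp(-β S_{a+1,b}) dU / Z_{a+1,b}` and `⟨F⟩_{a,b}` agree.
[cite: Greensite2011Confinement, §4.3 (4.36)–(4.37), §4.4 (4.42)–(4.43)] -/
theorem twistedExpectation_add_one_fst {z : G} (hz : z ∈ Subgroup.center G)
    (q : {p : Fin d × Fin d // p.1 < p.2}) (a b : ZMod L) (F : GaugeConfig d L G → ℝ)
    (hF : ∀ U : GaugeConfig d L G,
      F ((fun e : Edge d L => if e.2 = q.1.2 ∧ e.1 q.1.1 = a + 1 ∧ e.1 q.1.2 = b then z⁻¹ else 1) *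
        U) = F U) :
    (∫ U : GaugeConfig d L G, F U * Real.exp (-(β * insertedWilsonAction ρ
        (stackInsertion z q (a + 1) b) U)) ∂(Measure.pi fun _ : Edge d L => haarProbability G)) /
        insertedPartitionFunction ρ β L (stackInsertion z q (a + 1) b) =
      (∫ U : GaugeConfig d L G, F U * Real.exp (-(β * insertedWilsonAction ρ
        (stackInsertion z q a b) U)) ∂(Measure.pi fun _ : Edge d L => haarProbability G)) /
        insertedPartitionFunction ρ β L (stackInsertion z q a b) := by
  rw [integral_mul_exp_stackInsertion_add_one_fst ρ β hz q a b F hF,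
    insertedPartitionFunction_stackInsertion_add_one_fst ρ β hz q a b]

/-- **Twisted expectations do not see the position of the stack (step in direction `ν`).** Under
the hypothesis of `integral_mul_exp_stackInsertion_add_one_snd` the normalised twisted
expectations `⟨F⟩_{a,b+1}` and `⟨F⟩_{a,b}` agree.
[cite: Greensite2011Confinement, §4.3 (4.36)–(4.37), §4.4 (4.42)–(4.43)] -/
theorem twistedExpectation_add_one_snd {z : G} (hz : z ∈ Subgroup.center G)
    (q : {p : Fin d × Fin d // p.1 < p.2}) (a b : ZMod L) (F : GaugeConfig d L G → ℝ)
    (hF : ∀ U : GaugeConfig d L G,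
      F ((fun e : Edge d L => if e.2 = q.1.1 ∧ e.1 q.1.1 = a ∧ e.1 q.1.2 = b + 1 then z else 1) *
        U) = F U) :
    (∫ U : GaugeConfig d L G, F U * Real.exp (-(β * insertedWilsonAction ρ
        (stackInsertion z q a (b + 1)) U)) ∂(Measure.pi fun _ : Edge d L => haarProbability G)) /
        insertedPartitionFunction ρ β L (stackInsertion z q a (b + 1)) =
      (∫ U : GaugeConfig d L G, F U * Real.exp (-(β * insertedWilsonAction ρ
        (stackInsertion z q a b) U)) ∂(Measure.pi fun _ : Edge d L => haarProbability G)) /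
        insertedPartitionFunction ρ β L (stackInsertion z q a b) := by
  rw [integral_mul_exp_stackInsertion_add_one_snd ρ β hz q a b F hF,
    insertedPartitionFunction_stackInsertion_add_one_snd ρ β hz q a b]

end Transport

/-! ## The registered stub -/

/-- **Stub `stub_twistStackTransport` of line `Sketch`** ("the twist is a boundary condition" at
the level of observables, side-stub of the 't Hooft flux-sector mechanism): for central `z`, the
stack of `z`-twisted `q`-plaquettes `{x_μ = a + 1, x_ν = b}` may be moved to `{x_μ = a, x_ν = b}`
without changing the twisted weight of any integrand `F` blind to the substitution `U ↦ cU`,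
`c = z⁻¹` on the `ν`-links based in `{y_μ = a + 1, y_ν = b}` and `1` elsewhere
(`integral_mul_exp_stackInsertion_add_one_fst` with the registered binder structure).
[cite: Greensite2011Confinement, §4.3 (4.36)–(4.37), §4.4 (4.42)–(4.43)] -/
theorem stub_twistStackTransport : ∀ (d : ℕ) (G : Type) [Group G] [TopologicalSpace G] [IsTopologicalGroup G] [CompactSpace G] [MeasurableSpace G] [BorelSpace G] (N : ℕ) (ρ : G →* Matrix (Fin N) (Fin N) ℂ) (z : G), z ∈ Subgroup.center G → ∀ (β : ℝ) (L : ℕ) [NeZero L] (q : {p : Fin d × Fin d // p.1 < p.2}) (a b : ZMod L) (F : Literature.MathematicalPhysics.QuantumFieldTheory.GaugeConfig d L G → ℝ), (∀ U : Literature.MathematicalPhysics.QuantumFieldTheory.GaugeConfig d L G, F ((fun e : Literature.MathematicalPhysics.QuantumFieldTheory.Edge d L => if e.2 = q.1.2 ∧ e.1 q.1.1 = a + 1 ∧ e.1 q.1.2 = b then z⁻¹ else 1) * U) = F U) → (∫ U, F U * Real.exp (-(β * Literature.MathematicalPhysics.QuantumFieldTheory.insertedWilsonAction ρ (Literature.MathematicalPhysics.QuantumFieldTheory.stackInsertion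 z q (a + 1) b) U)) ∂(MeasureTheory.Measure.pi fun _ : Literature.MathematicalPhysics.QuantumFieldTheory.Edge d L => Literature.MathematicalPhysics.QuantumFieldTheory.haarProbability G)) = ∫ U, F U * Real.exp (-(β * Literature.MathematicalPhysics.QuantumFieldTheory.insertedWilsonAction ρ (Literature.MathematicalPhysics.QuantumFieldTheory.stackInsertion z q a b) U)) ∂(MeasureTheory.Measure.pi fun _ : Literature.MathematicalPhysics.QuantumFieldTheory.Edge d L => Literature.MathematicalPhysics.QuantumFieldTheory.haarProbability G) := by
  intro d G _ _ _ _ _ _ N ρ z hz β L _ q a b F hF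
  exact integral_mul_exp_stackInsertion_add_one_fst ρ β hz q a b F hF

end Summit.QuantumFields.YangMills.Theorems.NonSimplyConnectedLatticeGap

end
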